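import Summits.Parity.GeneralizedHardyLittlewood.Theorems.BeyondDiagonalBeatsQuarter.CleanScales
import Literature.NumberTheory.LFunctions.LOneLowerBoundParityHalves
import HarnessLib

/-!
# K_B `BeyondDiagonalBeatsQuarter` (stmt-Parity-20343), Negative lane: bookkeeping lemmas for the
# strength certificate of the archived heart H⁻

Part 2/3 (cell landau-siegel, seat `ls-ref-1`, K-PLFE-W (d); the certificate is
`Negative/KernelDiagonalUpperStrength`). Elementary facts used on a block of prime levels `(N, 2N]`,
`N = D^{k₀}`, against a deep odd real character `χ mod D`:
* `hMinus_summand_eq` — the summand of H⁻ is the registered `kernelExcess` (`CleanScales`);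
* `compatible_of_odd` — a prime `q > D` with `χ(q) ≠ 1` has `(q, D) = 1` and `χ(−q) = 1` (`χ` odd, real);
* `le_rpow_of_pow_le` — `D ≤ q^δ` once `D^{k₀} ≤ q`, `k₀δ ≥ 1`;
* `depth_bound`, `split_le_rho`, `block_absurd` — the real-arithmetic bookkeeping of the depth condition
  `C·L(1,χ)·log⁴q ≤ s/256`, of the split-prime proportion `#Sp ≤ (s/1000)·#G` from (8.5), and of the final
  block contradiction;
* `mainScaleReal_le_three_mul_block`, `mainScaleReal_pos_of_le` — comparable, positive scales on a block.
Standard axioms; no statement or definition is added. [folklore]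
-/

noncomputable section

open scoped Real
open Finset Complex Polynomial

namespace Summit.Parity.GeneralizedHardyLittlewood.Theorems.BeyondDiagonalBeatsQuarter.Negative

open Literature.NumberTheory.LFunctions
open Literature.NumberTheory.LFunctions.KMV2000

/-! ## §0. The H⁻ summand is the pointwise kernel excess -/

/-- The H⁻ summand at a non-zero level is the pointwise kernel excess `kernelExcess Δ′ q` of
`CleanScales`. [cite: KowalskiMichelVanderKam2000, §6 p. 19] -/
theorem hMinus_summand_eq (Δ' : ℝ) (q : ℕ) (hq0 : q ≠ 0) :
    ((if hq : q = 0 then (0 : ℂ) else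
        (haveI : NeZero q := ⟨hq⟩; KMV2000.QhPQ q (X ^ 2) 1 (KMV2000.qhat q ^ Δ'))) -
      ((2 * KMV2000.qhat q *
          ∑ m₁ ∈ Icc 1 ⌊KMV2000.qhat q ^ Δ'⌋₊, ∑ m₂ ∈ Icc 1 ⌊KMV2000.qhat q ^ Δ'⌋₊,
            ((ArithmeticFunction.moebius m₁ : ℝ) *
                ((KMV2000.psi m₁)⁻¹ * (X ^ 2 : ℝ[X]).eval
                  (Real.log (KMV2000.qhat q ^ Δ' / m₁) / Real.log (KMV2000.qhat q ^ Δ')))) *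
              ((ArithmeticFunction.moebius m₂ : ℝ) *
                ((KMV2000.psi m₂)⁻¹ * (X ^ 2 : ℝ[X]).eval
                  (Real.log (KMV2000.qhat q ^ Δ' / m₂) / Real.log (KMV2000.qhat q ^ Δ')))) *
              KMV2000.kmvKernel (Real.log (KMV2000.qhat q)) m₁ m₂ : ℝ) : ℂ)).re =
      kernelExcess Δ' q := by
  unfold kernelExcess
  rw [dif_neg hq0, dif_neg hq0, Complex.sub_re, Complex.ofReal_re]

/-! ## Compatibility of non-split primes for an odd character -/

/-- For an odd real character `χ mod D` and a prime `q > D` with `χ(q) ≠ 1`: `(q, D) = 1` and `χ(−q) = 1`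
(`q` is a unit mod `D`, so `χ(q) = −1`, and `χ(−1) = −1`). [folklore] -/
theorem compatible_of_odd {D : ℕ} [NeZero D] {χ : DirichletCharacter ℂ D} (hquad : MulChar.IsQuadratic χ)
    (hodd : χ.Odd) {q : ℕ} (hp : q.Prime) (hqD : D < q) (hne : ¬ χ ((q : ℕ) : ZMod D) = 1) :
    q.Coprime D ∧ χ (-((q : ℕ) : ZMod D)) = 1 := by
  have hcop : q.Coprime D :=
    (Nat.Prime.coprime_iff_not_dvd hp).2 fun hdvd ↦
      absurd (Nat.le_of_dvd (Nat.pos_of_ne_zero (NeZero.ne D)) hdvd) (by omega)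
  have hu : IsUnit ((q : ℕ) : ZMod D) := (ZMod.isUnit_iff_coprime q D).2 hcop
  have hχq0 : χ ((q : ℕ) : ZMod D) ≠ 0 := by
    intro h0
    have h1 : χ ((q : ℕ) : ZMod D) * χ (((q : ℕ) : ZMod D)⁻¹) = 1 := by
      rw [← map_mul, ZMod.mul_inv_of_unit _ hu, map_one]
    rw [h0, zero_mul] at h1
    exact zero_ne_one h1
  have hχq : χ ((q : ℕ) : ZMod D) = -1 := by
    rcases hquad ((q : ℕ) : ZMod D) with h0 | h0 | h0
    · exact absurd h0 hχq0
    · exact absurd h0 hne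
    · exact h0
  refine ⟨hcop, ?_⟩
  rw [neg_eq_neg_one_mul, map_mul, hχq]
  have : χ (-1) = -1 := hodd
  rw [this]; norm_num

/-! ## Real-arithmetic bookkeeping -/

/-- `D ≤ q^δ` once `D^{k₀} ≤ q` and `k₀δ ≥ 1` (`D ≥ 1`, `δ ≥ 0`). [folklore] -/
theorem le_rpow_of_pow_le {D q δ : ℝ} {k₀ : ℕ} (hD1 : 1 ≤ D) (hδ : 0 ≤ δ) (hk : 1 ≤ (k₀ : ℝ) * δ)
    (hq : D ^ k₀ ≤ q) : D ≤ q ^ δ := by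
  have hD0 : 0 ≤ D := le_trans zero_le_one hD1
  have e1 : (D ^ k₀) ^ δ = D ^ ((k₀ : ℝ) * δ) := by
    rw [← Real.rpow_natCast, ← Real.rpow_mul hD0]
  calc D = D ^ (1 : ℝ) := (Real.rpow_one _).symm
    _ ≤ D ^ ((k₀ : ℝ) * δ) := Real.rpow_le_rpow_of_exponent_le hD1 hk
    _ = (D ^ k₀) ^ δ := e1.symm
    _ ≤ q ^ δ := Real.rpow_le_rpow (by positivity) hq hδ

/-- The depth bookkeeping: `C·r·L⁴ ≤ ε` from `r ≤ t`, `t·B⁴ < c ≤ ε/(C·A⁴)`, `0 ≤ L ≤ A·B`. [folklore] -/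
theorem depth_bound {C t r c A L B ε : ℝ} (hC : 0 < C) (ht : 0 ≤ t) (hr : r ≤ t) (htc : t * B ^ 4 < c)
    (hc : c ≤ ε / (C * A ^ 4)) (hA : 0 < A) (hL0 : 0 ≤ L) (hL : L ≤ A * B) : C * r * L ^ 4 ≤ ε := by
  have h1 : C * r * L ^ 4 ≤ C * t * L ^ 4 :=
    mul_le_mul_of_nonneg_right (mul_le_mul_of_nonneg_left hr hC.le) (by positivity)
  have h2 : L ^ 4 ≤ (A * B) ^ 4 := pow_le_pow_left₀ hL0 hL 4
  have h3 : C * t * L ^ 4 ≤ C * t * (A * B) ^ 4 := mul_le_mul_of_nonneg_left h2 (by positivity)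
  have h4 : C * t * (A * B) ^ 4 = C * A ^ 4 * (t * B ^ 4) := by ring
  have h5 : C * A ^ 4 * (t * B ^ 4) ≤ C * A ^ 4 * c := mul_le_mul_of_nonneg_left htc.le (by positivity)
  have h6 : C * A ^ 4 * c ≤ ε := by
    have hpos : 0 < C * A ^ 4 := by positivity
    have := (le_div_iff₀ hpos).1 hc
    linarith
  linarith

/-- The split-prime bookkeeping: `#Sp ≤ ρ·#G` from (8.5) `#Sp ≤ C·re L(1,χ)·N·(k ℓ)`, `|re L(1,χ)| ≤ t`,
`t·ℓ⁴ < c ≤ ρ/(2(|C|+1)k²)`, `ℓ ≥ 1`, and the prime count `N ≤ 2(kℓ)·#G`. [folklore] -/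
theorem split_le_rho {Sp G N C r t k ℓ c ρ : ℝ} (h1 : Sp ≤ C * r * N * (k * ℓ)) (habs : |r| ≤ t)
    (ht : 0 ≤ t) (hN0 : 0 ≤ N) (hN : N ≤ 2 * (k * ℓ) * G) (hG : 0 ≤ G) (hℓ1 : 1 ≤ ℓ) (hk : 0 < k)
    (htc : t * ℓ ^ 4 < c) (hc0 : 0 < c) (hc2 : c ≤ ρ / (2 * (|C| + 1) * k ^ 2)) : Sp ≤ ρ * G := by
  have hℓ0 : 0 < ℓ := by linarith
  have hNl : 0 ≤ N * (k * ℓ) := by positivity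
  have a1 : C * r * N * (k * ℓ) ≤ |C| * t * (N * (k * ℓ)) := by
    have : C * r ≤ |C| * t :=
      calc C * r ≤ |C * r| := le_abs_self _
        _ = |C| * |r| := abs_mul _ _
        _ ≤ |C| * t := mul_le_mul_of_nonneg_left habs (abs_nonneg _)
    calc C * r * N * (k * ℓ) = C * r * (N * (k * ℓ)) := by ring
      _ ≤ |C| * t * (N * (k * ℓ)) := mul_le_mul_of_nonneg_right this hNl
  have a2 : |C| * t * (N * (k * ℓ)) ≤ |C| * t * ((2 * (k * ℓ) * G) * (k * ℓ)) := by
    refine mul_le_mul_of_nonneg_left ?_ (by positivity)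
    exact mul_le_mul_of_nonneg_right hN (by positivity)
  have a3 : |C| * t * ((2 * (k * ℓ) * G) * (k * ℓ)) = 2 * |C| * k ^ 2 * (t * ℓ ^ 2) * G := by ring
  have htℓ2 : t * ℓ ^ 2 ≤ c := by
    have : ℓ ^ 2 ≤ ℓ ^ 4 := pow_le_pow_right₀ hℓ1 (by norm_num)
    have h' : t * ℓ ^ 2 ≤ t * ℓ ^ 4 := mul_le_mul_of_nonneg_left this ht
    linarith
  have a4 : 2 * |C| * k ^ 2 * (t * ℓ ^ 2) * G ≤ 2 * |C| * k ^ 2 * c * G :=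
    mul_le_mul_of_nonneg_right (mul_le_mul_of_nonneg_left htℓ2 (by positivity)) hG
  have a5 : 2 * |C| * k ^ 2 * c ≤ ρ := by
    have hpos : 0 < 2 * (|C| + 1) * k ^ 2 := by positivity
    have := (le_div_iff₀ hpos).1 hc2
    have h' : 0 ≤ 2 * c * k ^ 2 := by positivity
    linarith
  calc Sp ≤ C * r * N * (k * ℓ) := h1
    _ ≤ |C| * t * (N * (k * ℓ)) := a1
    _ ≤ |C| * t * ((2 * (k * ℓ) * G) * (k * ℓ)) := a2
    _ = 2 * |C| * k ^ 2 * (t * ℓ ^ 2) * G := a3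
    _ ≤ 2 * |C| * k ^ 2 * c * G := a4
    _ ≤ ρ * G := mul_le_mul_of_nonneg_right a5 hG

/-- The block arithmetic: with `0 < s < 4`, `m₁ > 0`, `#G > 0`, `#Sp + #Co = #G`, `#Sp ≤ (s/1000)·#G`, the
bounds `KSp + KCo ≤ (s/16)(MSp + MCo)` (H⁻ on the block), `(s/4)·MCo ≤ KCo` (compatible primes),
`−8·MSp ≤ KSp` (split primes), `#Co·m₁/3 ≤ MCo`, `MSp ≤ #Sp·3m₁` (comparable scales) are incompatible.
[folklore] -/
theorem block_absurd {s m₁ G Sp Co KSp KCo MSp MCo : ℝ} (hs0 : 0 < s) (hs4 : s < 4) (hm₁ : 0 < m₁)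
    (hG : 0 < G) (hSC : Sp + Co = G) (hSpρ : Sp ≤ s / 1000 * G)
    (hH : KSp + KCo ≤ s / 16 * (MSp + MCo)) (hCoK : s / 4 * MCo ≤ KCo) (hSpK : -(8 * MSp) ≤ KSp)
    (hCoM : Co * (m₁ / 3) ≤ MCo) (hSpM : MSp ≤ Sp * (3 * m₁)) : False := by
  have i1 : 3 * s / 16 * MCo ≤ (8 + s / 16) * MSp := by linarith
  have l : 3 * s / 16 * (Co * (m₁ / 3)) ≤ 3 * s / 16 * MCo := mul_le_mul_of_nonneg_left hCoM (by positivity)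
  have r : (8 + s / 16) * MSp ≤ (8 + s / 16) * (Sp * (3 * m₁)) :=
    mul_le_mul_of_nonneg_left hSpM (by positivity)
  have i3 : s / 16 * Co ≤ (24 + 3 * s / 16) * Sp := by
    have i2 : (s / 16 * Co) * m₁ ≤ ((24 + 3 * s / 16) * Sp) * m₁ := by
      have e : 3 * s / 16 * (Co * (m₁ / 3)) = (s / 16 * Co) * m₁ := by ring
      have e' : (8 + s / 16) * (Sp * (3 * m₁)) = ((24 + 3 * s / 16) * Sp) * m₁ := by ring
      rw [← e, ← e']; linarith
    exact le_of_mul_le_mul_right i2 hm₁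
  have hCo : Co = G - Sp := by linarith
  rw [hCo] at i3
  have h' : (24 + s / 4) * Sp ≤ (24 + s / 4) * (s / 1000 * G) :=
    mul_le_mul_of_nonneg_left hSpρ (by positivity)
  have i4 : (s / 16) * G ≤ ((24 + s / 4) * (s / 1000)) * G := by linarith
  have i5 : s / 16 ≤ (24 + s / 4) * (s / 1000) := le_of_mul_le_mul_right i4 hG
  nlinarith [mul_pos hs0 (by linarith : (0 : ℝ) < 4 - s)]

/-! ## Scales on a block of levels -/

/-- Within a block `N < q, q' ≤ 2N` (`N ≥ 300`) the scales are comparable: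
`mainScaleReal Δ q ≤ 3·mainScaleReal Δ q'` (`norm_mainScale_le_three_mul`). [folklore] -/
theorem mainScaleReal_le_three_mul_block {N q q' : ℕ} (hN : 300 ≤ N) (h1 : N + 1 ≤ q) (h2 : q ≤ 2 * N)
    (h1' : N + 1 ≤ q') (h2' : q' ≤ 2 * N) {Δ : ℝ} (hΔ : 0 < Δ) :
    mainScaleReal Δ q ≤ 3 * mainScaleReal Δ q' := by
  haveI : NeZero q := ⟨by omega⟩
  haveI : NeZero q' := ⟨by omega⟩
  have key := norm_mainScale_le_three_mul h1 h2 h1' h2' (by omega) (by omega)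
    (one_le_log_qhat (by omega)) (one_le_log_qhat (by omega)) Δ hΔ
  rwa [norm_mainScale_eq_mainScaleReal, norm_mainScale_eq_mainScaleReal] at key

/-- `mainScaleReal Δ q > 0` for `q ≥ 300` (`log q̂ ≥ 1`) and `Δ > 0`. [folklore] -/
theorem mainScaleReal_pos_of_le {q : ℕ} {Δ : ℝ} (hΔ : 0 < Δ) (hq : 300 ≤ q) : 0 < mainScaleReal Δ q := by
  have hLq : 1 ≤ Real.log (qhat q) := one_le_log_qhat hq
  have hL0 : 0 < Real.log (qhat q) := by linarith
  have hqh : 0 < qhat q := lt_trans one_pos (one_lt_qhat (by omega))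
  have e : mainScaleReal Δ q = 2 * (π ^ 2 / 6) ^ 2 * (qhat q / (Δ ^ 2 * Real.log (qhat q) ^ 2)) := rfl
  rw [e]; positivity

end Summit.Parity.GeneralizedHardyLittlewood.Theorems.BeyondDiagonalBeatsQuarter.Negative

end
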